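import Literature.MathematicalPhysics.QuantumFieldTheory.Balaban1983to89.HiggsCovariancePos

/-!
# `Balaban1983to89.B3Eq116TwoSidedExpansion` — T. Bałaban, *(Higgs)₂,₃ quantum fields in a finite volume. III.
Renormalization*, Commun. Math. Phys. **88** (1983) 411–445 [Balaban1983Higgs3], p. 414, display **(1.16)**: the operator
`[G_k(Ω,B̃)V_k(Ã,B̃)]^n G_k(Ω,Ã+B̃) [V_k(Ã,B̃)G_k(Ω,B̃)]^{n′}` IS the last term of the two-sided expansion of the propagator
`G_k(Ω,Ã+B̃)` by the formulas (I.3.44), (I.3.45) of [Balaban1982Higgs1] — KERNEL-CHECKED in an arbitrary ring and, on the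
carriers of record `…HiggsCovariance.propagatorK`, for the actual lattice operators (the IDENTITY half of SKELETON row
B3.Eq1.16; the analytic half — the kernel regularity of (1.16), = the second alternative of (2.5) — is NOT proved here, see
HONEST SCOPE)

statement-level skeleton of published theorems with citation tags; proofs where landed; nothing here is a claim about the Yang–Mills mass gap

PDF held: `paper:balaban1983-higgs-2-3-quantum-fields-finite-volume` (journal page = PDF page + 410), p. 414 [PDF 4] read on the
text layer `p0004.txt` L19–33; [Balaban1982Higgs1] `paper:balaban1982-cmp85-higgs23-i` (journal page = PDF page + 602),
p. 619 [PDF 17] (3.44) and p. 620 [PDF 18] (3.45), text layer `p0017.txt` L31–35, `p0018.txt` L1–9.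

CITATION HEADER (lean-in-tree rule).  lit-balaban TYPED SKELETON (HOME `run/shared/lean/pub/lit-balaban/`), Phase 2, proof seat
p40 (gen 70, literature-prover-lit-balaban-p40-g70-0), free-target protocol G.5-34(d): SKELETON row **B3.Eq1.16** (owner r15,
ROWS-B3 `r15-B3-07`; status `typed p238938 · p239134 (carrier level …)`; referee ref-4) — LOCATED MEMBER, no head claim; the
operator-level instances of (I.3.44)/(I.3.45) below are also located members of rows **B1.Eq3.44** / **B1.Eq3.45** (heads
`proved-existing` by the abstract `B1.display344_of_316` / `B1.display345_of_344`; owners r12/r14).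

THE PRINTED SENTENCE (p. 414 [PDF 4] L19–24, verbatim from the text layer, OCR accents restored): *"Finally if we expand the
propagator G_k(Ω, Ã + B̃) using the formulas (I.3.44), (I.3.45), then in the last term of this expansion, equal to
[G_k(Ω, B̃)V_k(Ã, B̃)]^n G_k(Ω, Ã + B̃) [V_k(Ã, B̃)G_k(Ω, B̃)]^{n′}, (1.16) we have the propagator G_k(Ω, Ã + B̃)."*
[Balaban1982Higgs1] p. 619 (3.44): *"G_k(Ω,A+B) = G_k(Ω,B) + G_k(Ω,B)[F_{1,k}(−A)^*D^η_B + D^{η*}_B F_{1,k}(−A) −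
F_{1,k}(−A)^*F_{1,k}(−A) − a_kF_{2,k}(A,B)^*Q_k(B) − a_kQ_k^*(B)F_{2,k}(A,B) − a_kF_{2,k}(A,B)^*F_{2,k}(A,B)]G_k(Ω,A+B)"*;
p. 620: *"Let us denote the operator in the square bracket in (3.44) by V_k. Applying the formula (3.44) n̄ times we get the
expansion G_k(Ω,A+B) = Σ_{n=0}^{n̄} G_k(Ω,B)[V_kG_k(Ω,B)]^n + G_k(Ω,B)[V_kG_k(Ω,B)]^{n̄}V_kG_k(Ω,A+B). (3.45)"*.

WHAT THIS MODULE PROVES (sorry-free; two `def`s WITH BODIES — `opV`, `op116` —, no `Prop` fact introduced).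
§1 (abstract ring `𝔄` ↤ the operators on the scalar fields on `Ω`; dictionary `h` ↤ G_k(Ω,B̃), `g` ↤ G_k(Ω,Ã+B̃), `v` ↤ V_k(Ã,B̃),
as in `B1.display345_of_344`):
* `resolvent_of_diff_right` — the RIGHT resolvent identity `g = h + g·v·h` from `H_B·G_B = 1`, `G_{A+B}·H_{A+B} = 1`,
  `H_{A+B} = H_B − V` (the mirror image of the tree's `B1.resolvent_of_diff`, which gives (I.3.44) `g = h + h·v·g`);
* `display345_right_of_344` — (I.3.45) expanded FROM THE RIGHT: `g = Σ_{m<n′} h(vh)^m + g(vh)^{n′}` for every `n′`;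
* `pow_mul_conj` — `(hv)^m·h = h·(vh)^m`;
* **`display116_of_344`** — the TWO-SIDED expansion: from (I.3.44) and its mirror image, for EVERY `n, n′`,
  `g = Σ_{m < n+n′} h(vh)^m + (hv)^n · g · (vh)^{n′}` — the displayed operator (1.16) is exactly the last term;
* `display116_left` / `display116_right` — the one-sided cases `n′ = 0` (= (I.3.45) with n̄ + 1 = n, regrouped by
  `pow_mul_conj`) and `n = 0`;
* `star_term116` — in a *-ring with `h, g, v` self-adjoint, `((hv)^n g (vh)^{n′})^* = (hv)^{n′} g (vh)^n` (the kernel of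
  (1.16) is treated *"as a function of both variables"*, p. 414: the adjoint swaps the roles of `n` and `n′`).
§2 (the CARRIERS OF RECORD of rows B3.Eq2.5 / 2.10 / 2.11 / 3.1: `HiggsCovariance.propagatorK C Ω A m² a k` = the propagator
`G^ε_k(Ω,A)` of (I.2.20) on a region `Ω ⊆ T_ε` of the `HiggsLattice` tori, for a background vector field `A : VecField P 0`;
the rescaled propagator `G_k(Ω,A)` of (I.2.22) is the same construction over `Params.unitAt`, so everything below applies to it
verbatim):
* `opV C Ω A B m² a k` := `covOpK C Ω B m² a k − covOpK C Ω (A + B) m² a k` — the operator `V_k(A,B) = H_k(Ω,B) − H_k(Ω,A+B)`,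
  `H_k(Ω,X) = −Δ^{ε,N}_{X,Ω} + m² + a_k(L^kε)^{−2}P_k(X)`; that this difference IS the printed square bracket of (I.3.44) is
  formula (I.3.16), kernel-checked in the abstract *-ring form `B1.display316` / `B1.display344_of_316` (the concrete
  `F_{1,k}`/`F_{2,k}` decomposition is not re-derived on these carriers — see HONEST SCOPE (b));
* `op116 C Ω A B m² a k n n′` := `(G_B·V)^n · G_{A+B} · (V·G_B)^{n′}` — THE OPERATOR (1.16), with body;
* `eq344_model` / `eq344_model_right` — (I.3.44) and its mirror image for the actual operators, for every region `Ω`, every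
  pair of backgrounds `A, B`, `m² > 0`, `a_k ≥ 0` (two-sided invertibility = `HiggsCovariancePos.propagatorK_mul_covOpK` /
  `covOpK_mul_propagatorK`);
* `eq345_model` — (I.3.45) for the actual operators, every `n̄`;
* **`propagatorK_add_eq_sum_add_op116`** — `G_k(Ω,A+B) = Σ_{m<n+n′} G_k(Ω,B)(V_kG_k(Ω,B))^m + (1.16)` for every `n, n′`;
  `op116_zero_zero` (`n = n′ = 0`: (1.16) is `G_k(Ω,A+B)` itself), `op116_succ_left` / `op116_succ_right` (one more factor
  `G_BV` on the left / `VG_B` on the right);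
* `…_of_pos` forms with the paper's hypotheses `m² > 0`, `a > 0`, `L > 1`, `k ≥ 1` (`HiggsCovariancePos.isUnit_covOpK_of_pos`,
  `B1.aSeq_pos` (I.2.15)).

HONEST SCOPE.  (a) NOT PROVED HERE — the ANALYTIC half of (1.16) and of row B3.Eq1.16: p. 414, *"for n, n′ sufficiently large, a
kernel of the operator (1.16) is a sufficiently regular function of both variables. More exactly the Hölder norms of the covariant
derivatives of this kernel, the norms defined for example in the inequalities (I.2.24) and (I.2.25) of Proposition I.2.1, are
exponentially decaying with the distance of the arguments and are uniformly bounded by O(1)(e(L^kε)^{1−α})^{n+n′}, where α > 0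
but can be arbitrarily small. This estimate follows easily from the properties of the propagators G_k(Ω,Ã) proved in the next
paper"* — which is the second alternative of (2.5) p. 424 (`B3Sect2StatementsPart2.ScaledKernels.Ineq25`, clause (ii), the
`norm116` bound).  Every landed member of (2.5) sets `norm116 := 0` (`B3Ineq25ZeroNest`, `B3Ineq25ZeroLattice`,
`B3Ineq25ConstNest`), so that clause has no genuine member in the tree; a genuine one needs the scale-by-scale convolution of the
(2.6) pieces `G^η_{(j)}` with `n + n′ ≥ n₀(d)` factors (the kernel of `G_k(Ω,·)` itself — the case `n = n′ = 0` of (1.16), cf.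
`op116_zero_zero` — is singular on the diagonal in `d = 2, 3`), i.e. Proposition 2.1's mechanism, and is recorded as open in
HOME `lit-balaban-r15/ROWS-B3.md` row B3.Eq1.16 / B3.Eq2.5.  (b) `opV` is DEFINED as the difference `H_k(Ω,B) − H_k(Ω,A+B)`
(so (I.3.44) holds by pure algebra); its printed form — the square bracket of (I.3.44) in `F_{1,k}`, `F_{2,k}` — is (I.3.16),
available in the tree only as the abstract *-ring identity `B1.display316` (dictionary in its docstring); a concrete
`F_{1,k}`/`F_{2,k}` decomposition of `covOpK` on these carriers is not part of this file.  (c) Nothing is claimed about the sizes of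
the terms: §1–§2 are identities.  (d) Hypotheses of §2 = existence of the two propagators (two-sided units), discharged for
`m² > 0`, `a_k ≥ 0` (resp. `a > 0`, `L > 1`, `k ≥ 1`) by `HiggsCovariancePos`; `m² = 0` is not covered (as everywhere on these
carriers).
-/

namespace Literature.MathematicalPhysics.QuantumFieldTheory.Balaban1983to89.B3Eq116TwoSidedExpansion

open scoped BigOperators

/-! ## §1. The two-sided expansion in an arbitrary ring -/

section Ring

variable {𝔄 : Type*} [Ring 𝔄]

/-- The RIGHT resolvent identity (pure ring algebra; mirror image of `B1.resolvent_of_diff`): if `H_B` is a LEFT-invertible by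
`G_B` from the right (`H_B·G_B = 1`), `G_{A+B}` a left inverse of `H_{A+B}` and `H_{A+B} = H_B − V`, then
`G_{A+B} = G_B + G_{A+B}·V·G_B`.  With `B1.resolvent_of_diff` this is the pair of identities behind (I.3.44) read from either
side. [cite: Balaban1982Higgs1, (3.44) p.619] -/
theorem resolvent_of_diff_right (hB hAB gB gAB v : 𝔄) (hgB : hB * gB = 1) (hgAB : gAB * hAB = 1)
    (hdiff : hAB = hB - v) : gAB = gB + gAB * v * gB := by
  have hv : v = hB - hAB := by rw [hdiff]; abel
  have key : gAB * v * gB = gAB - gB := by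
    rw [hv, mul_sub, sub_mul, mul_assoc gAB hB gB, hgB, mul_one, hgAB, one_mul]
  rw [key]
  abel

/-- `(hv)^m · h = h · (vh)^m` — regrouping a chain `h v h v … v h`. [cite: Balaban1982Higgs1, (3.45) p.620] -/
theorem pow_mul_conj (h v : 𝔄) (m : ℕ) : (h * v) ^ m * h = h * (v * h) ^ m := by
  induction m with
  | zero => simp
  | succ m ih =>
    calc (h * v) ^ (m + 1) * h = (h * v) ^ m * h * (v * h) := by rw [pow_succ]; noncomm_ring
      _ = h * (v * h) ^ (m + 1) := by rw [ih, pow_succ, mul_assoc]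

/-- **(I.3.45) FROM THE RIGHT**: iterating the right resolvent identity `g = h + g·v·h` gives, for every `n′`,
`g = Σ_{m<n′} h(vh)^m + g·(vh)^{n′}` (for `n′ = 0` the sum is empty). [cite: Balaban1982Higgs1, (3.45) p.620] -/
theorem display345_right_of_344 (h g v : 𝔄) (h344r : g = h + g * v * h) (n' : ℕ) :
    g = (∑ m ∈ Finset.range n', h * (v * h) ^ m) + g * (v * h) ^ n' := by
  induction n' with
  | zero => simp
  | succ N ih =>
    have step : g * (v * h) ^ N = h * (v * h) ^ N + g * (v * h) ^ (N + 1) := by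
      conv_lhs => rw [h344r]
      rw [pow_succ']
      noncomm_ring
    rw [Finset.sum_range_succ, add_assoc, ← step]
    exact ih

/-- **(1.16) IS THE LAST TERM OF THE TWO-SIDED EXPANSION** (p. 414): from (I.3.44) `g = h + h·v·g` and its mirror image
`g = h + g·v·h`, for EVERY `n, n′`:  `g = Σ_{m < n+n′} h(vh)^m + (hv)^n · g · (vh)^{n′}`.  DICTIONARY: `h` ↤ G_k(Ω,B̃),
`g` ↤ G_k(Ω,Ã+B̃), `v` ↤ V_k(Ã,B̃); the last term ↤ the operator (1.16) `[G_k(Ω,B̃)V_k]^n G_k(Ω,Ã+B̃)[V_kG_k(Ω,B̃)]^{n′}`.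
[cite: Balaban1983Higgs3, (1.16) p.414] -/
theorem display116_of_344 (h g v : 𝔄) (h344 : g = h + h * v * g) (h344r : g = h + g * v * h) (n n' : ℕ) :
    g = (∑ m ∈ Finset.range (n + n'), h * (v * h) ^ m) + (h * v) ^ n * g * (v * h) ^ n' := by
  induction n with
  | zero => simpa using display345_right_of_344 h g v h344r n'
  | succ N ih =>
    -- `(hv)^N g (vh)^{n′} = h(vh)^{N+n′} + (hv)^{N+1} g (vh)^{n′}` by one more substitution of (I.3.44) on the left
    have hvg : h * v * g = g - h := by rw [eq_sub_iff_add_eq']; exact h344.symm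
    have step : (h * v) ^ N * g * (v * h) ^ n' =
        h * (v * h) ^ (N + n') + (h * v) ^ (N + 1) * g * (v * h) ^ n' := by
      have e1 : (h * v) ^ (N + 1) * g * (v * h) ^ n' =
          (h * v) ^ N * g * (v * h) ^ n' - (h * v) ^ N * h * (v * h) ^ n' := by
        rw [pow_succ, mul_assoc ((h * v) ^ N) (h * v) g, hvg, mul_sub, sub_mul]
      have e2 : (h * v) ^ N * h * (v * h) ^ n' = h * (v * h) ^ (N + n') := by
        rw [pow_mul_conj, mul_assoc, ← pow_add]
      rw [e1, e2]
      abel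
    rw [Nat.add_right_comm, Finset.sum_range_succ, add_assoc, ← step]
    exact ih

/-- The case `n′ = 0` of `display116_of_344`: `g = Σ_{m<n} h(vh)^m + (hv)^n·g` — (I.3.45) with `n̄ + 1 = n` leading terms,
the remainder regrouped by `pow_mul_conj` (`h(vh)^{n̄}v·g = (hv)^{n̄+1}g`). [cite: Balaban1982Higgs1, (3.45) p.620] -/
theorem display116_left (h g v : 𝔄) (h344 : g = h + h * v * g) (h344r : g = h + g * v * h) (n : ℕ) :
    g = (∑ m ∈ Finset.range n, h * (v * h) ^ m) + (h * v) ^ n * g := by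
  simpa using display116_of_344 h g v h344 h344r n 0

/-- The case `n = 0` of `display116_of_344` (= `display345_right_of_344`). [cite: Balaban1982Higgs1, (3.45) p.620] -/
theorem display116_right (h g v : 𝔄) (h344 : g = h + h * v * g) (h344r : g = h + g * v * h) (n' : ℕ) :
    g = (∑ m ∈ Finset.range n', h * (v * h) ^ m) + g * (v * h) ^ n' := by
  simpa using display116_of_344 h g v h344 h344r 0 n'

/-- (I.3.45) as printed (`B1.display345_of_344`) and the `n′ = 0` two-sided form agree: the printed remainder
`h(vh)^{n̄}·v·g` IS `(hv)^{n̄+1}·g`. [cite: Balaban1982Higgs1, (3.45) p.620] -/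
theorem remainder345_eq (h g v : 𝔄) (nbar : ℕ) : h * (v * h) ^ nbar * v * g = (h * v) ^ (nbar + 1) * g := by
  rw [← pow_mul_conj, pow_succ, mul_assoc ((h * v) ^ nbar) h v]

end Ring

section StarRing

variable {𝔄 : Type*} [Ring 𝔄] [StarRing 𝔄]

/-- The kernel of (1.16) *"as a function of both variables"* (p. 414): for self-adjoint `h, g, v` the adjoint of the term
`(hv)^n g (vh)^{n′}` is the term with `n` and `n′` exchanged. [cite: Balaban1983Higgs3, (1.16) p.414] -/
theorem star_term116 (h g v : 𝔄) (hh : star h = h) (hg : star g = g) (hv : star v = v) (n n' : ℕ) :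
    star ((h * v) ^ n * g * (v * h) ^ n') = (h * v) ^ n' * g * (v * h) ^ n := by
  have s1 : star (h * v) = v * h := by rw [star_mul, hv, hh]
  have s2 : star (v * h) = h * v := by rw [star_mul, hh, hv]
  rw [star_mul, star_mul, star_pow, star_pow, s1, s2, hg, mul_assoc]

end StarRing

/-! ## §2. On the carriers of record: `G^ε_k(Ω, A)` = `HiggsCovariance.propagatorK` -/

section Model

open Literature.MathematicalPhysics.QuantumFieldTheory.Balaban1983to89.HiggsLattice
open Literature.MathematicalPhysics.QuantumFieldTheory.Balaban1983to89.HiggsCovariance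
open Literature.MathematicalPhysics.QuantumFieldTheory.Balaban1983to89.HiggsCovariancePos

variable {P : Params} {N : ℕ}

/-- The operator `V_k(A,B)` of (I.3.44)/(1.16) on the carriers of record, AS THE DIFFERENCE
`H_k(Ω,B) − H_k(Ω,A+B)`, `H_k(Ω,X) = −Δ^{ε,N}_{X,Ω} + m² + a_k(L^kε)^{−2}P_k(X)` = `HiggsCovariance.covOpK C Ω X m² a k`
(the operator inverted in (I.2.20)).  By (I.3.16) p. 615 this difference is the printed square bracket of (I.3.44),
`F_{1,k}(−A)^*D^η_B + D^{η*}_B F_{1,k}(−A) − F_{1,k}(−A)^*F_{1,k}(−A) − a_kF_{2,k}(A,B)^*Q_k(B) − a_kQ_k^*(B)F_{2,k}(A,B) −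
a_kF_{2,k}(A,B)^*F_{2,k}(A,B)` (kernel-checked abstractly: `B1.display316`, `B1.display344_of_316`); p. 620: *"Let us denote
the operator in the square bracket in (3.44) by V_k."* [cite: Balaban1982Higgs1, (3.44) p.619] -/
noncomputable def opV (C : ChargeData N) (Ω : Finset (Site P 0)) (A B : VecField P 0) (msq a : ℝ) (k : ℕ) :
    Module.End ℝ (ScalarField P 0 N) :=
  covOpK C Ω B msq a k - covOpK C Ω (A + B) msq a k

/-- **THE OPERATOR (1.16)** p. 414 on the carriers of record:
`[G_k(Ω,B)V_k(A,B)]^n G_k(Ω,A+B) [V_k(A,B)G_k(Ω,B)]^{n′}` with `G_k(Ω,X)` = `HiggsCovariance.propagatorK C Ω X m² a k`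
((I.2.20); for the rescaled (I.2.22) take the parameters `P.unitAt k`) and `V_k` = `opV`. [cite: Balaban1983Higgs3, (1.16) p.414] -/
noncomputable def op116 (C : ChargeData N) (Ω : Finset (Site P 0)) (A B : VecField P 0) (msq a : ℝ) (k : ℕ) (n n' : ℕ) :
    Module.End ℝ (ScalarField P 0 N) :=
  (propagatorK C Ω B msq a k * opV C Ω A B msq a k) ^ n * propagatorK C Ω (A + B) msq a k *
    (opV C Ω A B msq a k * propagatorK C Ω B msq a k) ^ n'

variable (C : ChargeData N) (Ω : Finset (Site P 0)) (A B : VecField P 0) {msq : ℝ} (a : ℝ) (k : ℕ)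

/-- `H_k(Ω,A+B) = H_k(Ω,B) − V_k(A,B)` — the definition of `opV` rearranged (the shape `hdiff` of `B1.resolvent_of_diff`).
[cite: Balaban1982Higgs1, (3.44) p.619] -/
theorem covOpK_add_eq_sub (msq : ℝ) : covOpK C Ω (A + B) msq a k = covOpK C Ω B msq a k - opV C Ω A B msq a k := by
  simp [opV]

/-- For `n = n′ = 0` the operator (1.16) is the propagator `G_k(Ω,A+B)` itself. [cite: Balaban1983Higgs3, (1.16) p.414] -/
theorem op116_zero_zero (msq : ℝ) : op116 C Ω A B msq a k 0 0 = propagatorK C Ω (A + B) msq a k := by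
  simp [op116]

/-- One more factor `G_k(Ω,B)V_k` on the left of (1.16). [cite: Balaban1983Higgs3, (1.16) p.414] -/
theorem op116_succ_left (msq : ℝ) (n n' : ℕ) :
    op116 C Ω A B msq a k (n + 1) n' = propagatorK C Ω B msq a k * opV C Ω A B msq a k * op116 C Ω A B msq a k n n' := by
  simp only [op116, pow_succ', mul_assoc]

/-- One more factor `V_kG_k(Ω,B)` on the right of (1.16). [cite: Balaban1983Higgs3, (1.16) p.414] -/
theorem op116_succ_right (msq : ℝ) (n n' : ℕ) :
    op116 C Ω A B msq a k n (n' + 1) = op116 C Ω A B msq a k n n' * (opV C Ω A B msq a k * propagatorK C Ω B msq a k) := by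
  simp only [op116, pow_succ, mul_assoc]

/-- **(I.3.44) for the actual lattice operators**: `G_k(Ω,A+B) = G_k(Ω,B) + G_k(Ω,B)V_k(A,B)G_k(Ω,A+B)` on every region
`Ω ⊆ T_ε`, for every pair of backgrounds `A, B`, `m² > 0`, `a_k ≥ 0`. [cite: Balaban1982Higgs1, (3.44) p.619] -/
theorem eq344_model (hmsq : 0 < msq) (hak : 0 ≤ B1.aSeq a P.L k) :
    propagatorK C Ω (A + B) msq a k =
      propagatorK C Ω B msq a k + propagatorK C Ω B msq a k * opV C Ω A B msq a k * propagatorK C Ω (A + B) msq a k :=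
  B1.resolvent_of_diff (covOpK C Ω B msq a k) (covOpK C Ω (A + B) msq a k) _ _ _
    (propagatorK_mul_covOpK C Ω B hmsq a k hak) (covOpK_mul_propagatorK C Ω (A + B) hmsq a k hak)
    (covOpK_add_eq_sub C Ω A B a k msq)

/-- **(I.3.44) from the right** for the actual lattice operators: `G_k(Ω,A+B) = G_k(Ω,B) + G_k(Ω,A+B)V_k(A,B)G_k(Ω,B)`.
[cite: Balaban1982Higgs1, (3.44) p.619] -/
theorem eq344_model_right (hmsq : 0 < msq) (hak : 0 ≤ B1.aSeq a P.L k) :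
    propagatorK C Ω (A + B) msq a k =
      propagatorK C Ω B msq a k + propagatorK C Ω (A + B) msq a k * opV C Ω A B msq a k * propagatorK C Ω B msq a k :=
  resolvent_of_diff_right (covOpK C Ω B msq a k) (covOpK C Ω (A + B) msq a k) _ _ _
    (covOpK_mul_propagatorK C Ω B hmsq a k hak) (propagatorK_mul_covOpK C Ω (A + B) hmsq a k hak)
    (covOpK_add_eq_sub C Ω A B a k msq)

/-- **(I.3.45) for the actual lattice operators**, every `n̄`:
`G_k(Ω,A+B) = Σ_{n=0}^{n̄} G_k(Ω,B)[V_kG_k(Ω,B)]^n + G_k(Ω,B)[V_kG_k(Ω,B)]^{n̄}V_kG_k(Ω,A+B)`. [cite: Balaban1982Higgs1, (3.45) p.620] -/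
theorem eq345_model (hmsq : 0 < msq) (hak : 0 ≤ B1.aSeq a P.L k) (nbar : ℕ) :
    propagatorK C Ω (A + B) msq a k =
      (∑ n ∈ Finset.range (nbar + 1), propagatorK C Ω B msq a k * (opV C Ω A B msq a k * propagatorK C Ω B msq a k) ^ n) +
        propagatorK C Ω B msq a k * (opV C Ω A B msq a k * propagatorK C Ω B msq a k) ^ nbar * opV C Ω A B msq a k *
          propagatorK C Ω (A + B) msq a k :=
  B1.display345_of_344 _ _ _ (eq344_model C Ω A B a k hmsq hak) nbar

/-- **(1.16) IS THE LAST TERM** (p. 414) for the actual lattice operators: for every `n, n′`,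
`G_k(Ω,A+B) = Σ_{m<n+n′} G_k(Ω,B)[V_kG_k(Ω,B)]^m + [G_k(Ω,B)V_k]^n G_k(Ω,A+B) [V_kG_k(Ω,B)]^{n′}`, on every region `Ω ⊆ T_ε`,
for every pair of backgrounds `A, B`, `m² > 0`, `a_k ≥ 0`. [cite: Balaban1983Higgs3, (1.16) p.414] -/
theorem propagatorK_add_eq_sum_add_op116 (hmsq : 0 < msq) (hak : 0 ≤ B1.aSeq a P.L k) (n n' : ℕ) :
    propagatorK C Ω (A + B) msq a k =
      (∑ m ∈ Finset.range (n + n'), propagatorK C Ω B msq a k * (opV C Ω A B msq a k * propagatorK C Ω B msq a k) ^ m) +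
        op116 C Ω A B msq a k n n' :=
  display116_of_344 _ _ _ (eq344_model C Ω A B a k hmsq hak) (eq344_model_right C Ω A B a k hmsq hak) n n'

/-- The paper's hypotheses: `m² > 0`, `a > 0`, `L > 1`, `k ≥ 1` (then `a_k > 0`, `B1.aSeq_pos`, (I.2.15)) — (I.3.44).
[cite: Balaban1982Higgs1, (3.44) p.619] -/
theorem eq344_model_of_pos {a : ℝ} (hmsq : 0 < msq) (ha : 0 < a) (hL : 1 < (P.L : ℝ)) {k : ℕ} (hk : 1 ≤ k) :
    propagatorK C Ω (A + B) msq a k =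
      propagatorK C Ω B msq a k + propagatorK C Ω B msq a k * opV C Ω A B msq a k * propagatorK C Ω (A + B) msq a k :=
  eq344_model C Ω A B a k hmsq (B1.aSeq_pos ha hL hk).le

/-- The paper's hypotheses: `m² > 0`, `a > 0`, `L > 1`, `k ≥ 1` — (1.16) is the last term of the two-sided expansion, every
`n, n′`. [cite: Balaban1983Higgs3, (1.16) p.414] -/
theorem propagatorK_add_eq_sum_add_op116_of_pos {a : ℝ} (hmsq : 0 < msq) (ha : 0 < a) (hL : 1 < (P.L : ℝ)) {k : ℕ}
    (hk : 1 ≤ k) (n n' : ℕ) :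
    propagatorK C Ω (A + B) msq a k =
      (∑ m ∈ Finset.range (n + n'), propagatorK C Ω B msq a k * (opV C Ω A B msq a k * propagatorK C Ω B msq a k) ^ m) +
        op116 C Ω A B msq a k n n' :=
  propagatorK_add_eq_sum_add_op116 C Ω A B a k hmsq (B1.aSeq_pos ha hL hk).le n n'

/-- Applied to a field `φ`: the value of `G_k(Ω,A+B)φ` is the sum of the `n + n′` Born terms and of the operator (1.16)
applied to `φ`. [cite: Balaban1983Higgs3, (1.16) p.414] -/
theorem propagatorK_add_apply (hmsq : 0 < msq) (hak : 0 ≤ B1.aSeq a P.L k) (n n' : ℕ) (φ : ScalarField P 0 N) :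
    propagatorK C Ω (A + B) msq a k φ =
      (∑ m ∈ Finset.range (n + n'),
          (propagatorK C Ω B msq a k * (opV C Ω A B msq a k * propagatorK C Ω B msq a k) ^ m) φ) +
        op116 C Ω A B msq a k n n' φ := by
  have h := congrArg (fun T : Module.End ℝ (ScalarField P 0 N) => T φ)
    (propagatorK_add_eq_sum_add_op116 C Ω A B a k hmsq hak n n')
  simpa only [LinearMap.add_apply, LinearMap.sum_apply] using h

end Model

end Literature.MathematicalPhysics.QuantumFieldTheory.Balaban1983to89.B3Eq116TwoSidedExpansion
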